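import Literature.MathematicalPhysics.QuantumFieldTheory.Balaban1983to89.B13CurlIncidenceNumerals
import Literature.MathematicalPhysics.QuantumFieldTheory.Balaban1983to89.B13BondAveragingReadingNumerals
import Literature.MathematicalPhysics.QuantumFieldTheory.Balaban1983to89.B9Thm310CommutatorBound389B

/-!
# `Balaban1983to89.B13DeltaAPencilLettersLocated` — T. Bałaban, *Propagators for lattice gauge theories in a background field*, Commun. Math. Phys. **99** (1985)
# 389–434 [Balaban1985BackgroundPropagators], (3.26)–(3.27) p. 395 (`Δ_a(U) = Δ(U) + D_U R(U) D*_U + Q*(U)aQ(U)`, `G(U) = Δ_a(U)⁻¹`), Thm 3.4 and (3.50) p. 400,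
# (3.84)–(3.86) p. 407, Thm 3.10 (3.107)–(3.108) p. 416; *Renormalization group approach to lattice gauge field theories. II*, Commun. Math. Phys. **116** (1988)
# 1–22 [Balaban1988RG2Cluster], (2.5)–(2.7) pp. 12–13, p. 15: ★★★ MODULE 76 (`B13OpsYPencilDeltaALetters` §4 ∕ §5 ∕ §6) LOCATED — EVERY NODE-00 NUMERAL A NUMBER
# at the record's letter algebra `M_N(ℂ)`, matrix-unit coordinates, the fine-bond reading `bondReadingY`, and a unitary-valued background `U₀`.

THE DISPLAY OF 76.  Module 76 packages the local part `Δ(U) + Q*(U)aQ(U)` of NODE 00's `Δ_a(U)` along pv27's group pencil `A′ ↦ e^{iηA′}U₀` as N10 letter data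
(§4), adds the projection term's letters to get the `Δ_a` socket (§5), and inverts through Sect. B to get the G-junction modulo the projection term (§6).  Besides
the two OPERATOR-side inputs (the projection term's pencil letters `hP`; N06's `IsUnit (Δ_a(U₀))` and pointwise (3.108) bound at the real background) and the
pencil parameters `(η, Rc, ρ, ρ′)`, it DISPLAYS the following NODE-00 ∕ reading ∕ coordinate numerals: the background size `K₀` (`hU hUi hK1`), the curl rows
`c₁ c₂ N_b`, the averaging rows `hD hD′ c_Q c_{Q*} c_a`, the basis numerals `cb cl`, the reading rows `hℓp hℓq` and a fibre bound `m`.  As of today EVERY ONE of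
them is a number or a tree theorem BY NAME:
* `K₀ = 1` for a `G`-valued background with `G ≤ U(N)` (79 `B13GreenPrimeSymLettersOfReg335.norm_unit_le_one_of_mem`);
* `c₁ = 4|c_f|`, `c₂ = 4(d+1)|c_f|`, `N_b = 4(d+1)` (dag-n10-w6's `B13CurlIncidenceNumerals`, whose §3 `…_curlNumerals` editions of 76 this file applies positionally);
* `hD ∕ hD′` with `D_Q = (d+2)(L^k − 1)`, `c_a = w_ι` (this seat's `B13BondAveragingReadingNumerals.hD_qK ∕ hD'_qsK ∕ sum_abs_aK_eq`), here bounded through the index's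
  declared weight band `KIdx.hwb : GlobalBand b₀ b₁ c_f w` by **`c_a = |b₁|·c_f²·(L^k)^{d+1}`** (§1 `hca_of_globalBand`); `c_Q = 1` (n06's
  `B9Eq3104CommutatorSizesAvg.sum_abs_qK_eq_one`); `c_{Q*} ≤ 2` (n06's `B9Thm310CommutatorBound389B.sum_abs_qsK_le`, `(L^{d+1})^{−lev} ≤ 1`);
* `cb = cl = 1` at the matrix units of `M_N(ℂ)` under the L²-operator norm (dag-n10-w2's `B13MatrixUnitBasisNumerals`);
* `hℓp ≤ 2` (this seat's `B13BlockBondReadingNumerals.hℓp_bondReadingY`) and `hℓq ≤ 2·D_Q` (`B13BondAveragingReadingNumerals.hℓq_bondReadingY`) at the FINE-BOND reading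
  `ℓF = bondReadingY` that goes with dag-n10-w6's `fineReadingY` — ONE range numeral `s = 2·D_Q = 2(d+2)(L^k − 1)` serves both (`2 ≤ s`, §1) —, fibre `m = (d+1)·N²`
  (`card_fibre_bondReadingY_matrixUnits`).
THIS FILE substitutes them all: §2 ★★ 76 §4 LOCATED, §3 ★★ 76 §5 LOCATED (the `Δ_a` socket), §4 ★★★ 76 §6 LOCATED (the G-junction modulo the projection term),
each displaying ONLY `hG : G ≤ U(N)`, `hU₀ : U₀ ∈ G` bondwise, `hNf` (the period vector of the reading torus), `η`, `Rc`, `ρ` (`ρ′`), and the operator-side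
inputs `hP` (§3, §4), `hunit ∕ hBG ∕ hO` (§4) VERBATIM at the located reading.  The constants are 76's with the numbers written in (no simplification: the terms
`1 * Real.exp (|η| * Rc)` are `K₀e^{|η|Rc}` at `K₀ = 1`).

[folklore] positional application of cited tree theorems + three lines of real arithmetic (§1); kernel-checked; THEOREMS ONLY (no `def`, no `structure`, no
instance, no notation; `open scoped Matrix.Norms.L2Operator` = the record's norm, as in `Node00.lettersYOfRecord` ∕ `B13MatrixUnitBasisNumerals`); NOTHING of
NODE 00's ∕ pv27's ∕ module 76's ∕ the cited numeral files is modified; nothing here is a claim about the Yang–Mills mass gap; no node is discharged; count-neutral.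

WHY THIS FILE (cell `pub-ymgap`, HUMAN RULING D-0062 ∕ D-0149, Track A node N10 = [B13]; WIDTH SEAT `pub-ymgap-dag-n10-w4` g5, CLAIM-2 ∕ INTENT-2 (R455 (A), bus
I.34724) = the «76 all-numerals edition» offered in I.34576 and worded «yours as offered» by dag-n10-w6 g4; lane owner dag-n10-c's RESIDUAL CENSUS v18
«displayed binder classes of 67»).  WHICH reading ∕ coordinates ∕ background class the N10 term of record uses is NODE 00's ∕ def-T's word (census item 2) —
NOT claimed here; this is a LOCATED INSTANCE showing that, at one natural choice, the NODE-00 side of 76 carries no undetermined numeral.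

WHAT THIS FILE PROVES (all `theorem`s; `i : KIdx` def-Y's index, `L = ℓ + 1`, `k = i.k ≥ 2`, dimension `d + 1`; `N ≥ 1`; `G ≤ U(N)`; `hNf : N₀ = Nf`).
* §1 `hcQ_le_one` (`Σ_b |qK ι b| ≤ 1`, n06 BY NAME) · `hcQs_le_two` (`Σ_ι |qsK b ι| ≤ 2`, n06 BY NAME) · `weight_le_of_globalBand` (`w_ι ≤ |b₁|c_f²(L^k)^{d+1}`) ·
  ★ `hca_of_globalBand` (76's `hca` with that `c_a`) · `two_le_rangeQ2` (`2 ≤ 2(d+2)(L^k − 1)`) · `hℓp_bondReadingY_rangeQ2` (76's `hℓp` at `s = 2(d+2)(L^k − 1)`).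
* §2 ★★ `rawEntryLetters_toMatrix_localDeltaA_prodCfg_located` — 76 §4 with every NODE-00 ∕ reading ∕ basis numeral a number.
* §3 ★★ `rawEntryLetters_toMatrix_deltaAY_prodCfg_of_projection_located` — 76 §5 (the `Δ_a` socket) likewise; displayed: the projection term's letters `hP`.
* §4 ★★★ `rawEntryLetters_toMatrix_GAY_prodCfg_of_projection_located` — 76 §6 (the G-junction modulo `hP`) likewise; displayed: `hP`, N06's `hunit ∕ hBG ∕ hO`,
  `0 < Rc`, `0 ≤ ρ′ < ρ`.
HONEST FRAMING: located instance; the substituted numbers are finite-lattice constants at the coarsest scale (NOT optimised, NOT print's `O(1)`: e.g. `D_Q` pays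
the whole stencil reach, `c_{Q*} ≤ 2` forgets the level gain `(L^{d+1})^{−lev}`, `c_a` the level profile of the weights); the OPERATOR-side residue of the
G-junction is untouched and is exactly the inverse road's `hP` + N06's two centre inputs; nothing of Bałaban's asserted; N06 ∕ N10 NOT discharged; K1⁸
stmt-QuantumFields-26907 OPEN, no registered stub proved; counts unmoved (typed 28∕28 · discharged 5∕27); 0 `def`, 0 `sorry`, standard axioms; one finite
𝕋⁴ programme at fixed ε, Bałaban AS PRINTED — R4 closes the conditional finite-𝕋⁴ rung `BalabanLadder.UV` only; the YM mass gap (Clay) is NOT proved by any of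
this; nothing continuum ∕ ℝ⁴ ∕ OS.

References: T. Bałaban, CMP 99 (1985) 389–434 [Balaban1985BackgroundPropagators] (3.2)–(3.4) pp.390–391, (3.10) p.392, (3.12)–(3.13) p.392, (3.25)–(3.27)
pp.394–395, Thm 3.4 and (3.50) p.400, (3.84)–(3.86) p.407, Thm 3.10 (3.107)–(3.108) pp.415–416; CMP 116 (1988) 1–22 [Balaban1988RG2Cluster] (2.5)–(2.7)
pp.12–13, p.15; CMP 96 (1984) 223–250 [Balaban1984PropagatorsII] (2.16) p.225, (2.18)–(2.20) p.226, Lemma 2.1 (2.61) p.234; CMP 95 (1984) 17–40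
[Balaban1984PropagatorsI] (1.18) p.20.
-/

noncomputable section

namespace Literature.MathematicalPhysics.QuantumFieldTheory.Balaban1983to89.B13DeltaAPencilLettersLocated

open Finset Module
open scoped Matrix Matrix.Norms.L2Operator
open Literature.MathematicalPhysics.QuantumFieldTheory.Balaban1983to89
open Literature.MathematicalPhysics.QuantumFieldTheory.Balaban1983to89.B9Thm37GlueTorus (tdist1)
open Literature.MathematicalPhysics.QuantumFieldTheory.Balaban1983to89.B5TorusCover (UT)
open Literature.MathematicalPhysics.QuantumFieldTheory.Balaban1983to89.B13EntrywiseWalks (RawEntryLetters)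
open Literature.MathematicalPhysics.QuantumFieldTheory.Balaban1983to89.B9Eq39Adjoint (prodCfg)
open Literature.MathematicalPhysics.QuantumFieldTheory.Balaban1983to89.B6GlobalChartV1 (PV)
open Literature.MathematicalPhysics.QuantumFieldTheory.Balaban1983to89.B6KLevelCensusIndexV1 (KIdx)
open Literature.MathematicalPhysics.QuantumFieldTheory.Balaban1983to89.B6Ineq2142KLevelV1 (lvl_le)
open Literature.MathematicalPhysics.QuantumFieldTheory.Balaban1983to89.B15DeterminingSets (embIter)
open Literature.MathematicalPhysics.QuantumFieldTheory.Balaban1983to89.Node00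
  (SiteY FBondY IBondY PlaqY CfgY SiteParY SiteOpY qK qsK aK hessY QY QsY aY gradY divY RY deltaAY GAY parBY edgeY toKT levY)
open Literature.MathematicalPhysics.QuantumFieldTheory.Balaban1983to89.Node00.OpsYNablaBridge (chartY)
open Literature.MathematicalPhysics.QuantumFieldTheory.Balaban1983to89.B13CurlIncidenceNumerals
  (rawEntryLetters_toMatrix_localDeltaA_prodCfg_curlNumerals rawEntryLetters_toMatrix_deltaAY_prodCfg_of_projection_curlNumerals
    rawEntryLetters_toMatrix_GAY_prodCfg_of_projection_curlNumerals)
open Literature.MathematicalPhysics.QuantumFieldTheory.Balaban1983to89.B13BondAveragingReadingNumerals (hD_qK hD'_qsK sum_abs_aK_eq hℓq_bondReadingY)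
open Literature.MathematicalPhysics.QuantumFieldTheory.Balaban1983to89.B13BlockBondReadingNumerals
  (bondReadingY hℓp_bondReadingY card_fibre_bondReadingY_matrixUnits)
open Literature.MathematicalPhysics.QuantumFieldTheory.Balaban1983to89.B13MatrixUnitBasisNumerals (norm_stdBasis_repr_le norm_stdBasis_le_one)
open Literature.MathematicalPhysics.QuantumFieldTheory.Balaban1983to89.B13GreenPrimeSymLettersOfReg335 (norm_unit_le_one_of_mem)

variable {d ℓ : ℕ} {hd : 1 ≤ d + 1} {hL : Odd (ℓ + 1) ∧ 1 < ℓ + 1} {b₀ b₁ : ℝ}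
variable (i : KIdx d ℓ hd hL b₀ b₁)

/-! ## §1. The index's remaining NODE-00 rows as numbers: `c_Q = 1`, `c_{Q*} ≤ 2`, `c_a = |b₁|c_f²(L^k)^{d+1}`, `s = 2(d+2)(L^k − 1)` -/

section Numerals

/-- **76's `hcQ` WITH `c_Q = 1`** — n06's unit row sum `Σ_f |Q(y,f)| = 1` BY NAME (`B9Eq3104CommutatorSizesAvg.sum_abs_qK_eq_one`).
[cite: Balaban1985BackgroundPropagators, (3.12) p.392; Balaban1984PropagatorsI, (1.18) p.20] -/
theorem hcQ_le_one : ∀ ι : IBondY i, ∑ b, |qK i ι b| ≤ 1 := fun ι => (B9Eq3104CommutatorSizesAvg.sum_abs_qK_eq_one i ι).le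

/-- **76's `hcQs` WITH `c_{Q*} = 2`** — n06's column sum `Σ_y |Q*(b,y)| ≤ 2·(L^{d+1})^{−lev b}` BY NAME (`B9Thm310CommutatorBound389B.sum_abs_qsK_le`), and
`(L^{d+1})^{−lev} ≤ 1`. [cite: Balaban1985BackgroundPropagators, (3.13) p.392; Balaban1984PropagatorsII, (2.3)–(2.4) p.224, (2.18) p.226; Balaban1984PropagatorsI, (1.18) p.20] -/
theorem hcQs_le_two : ∀ b : FBondY i, ∑ ι, |qsK i b ι| ≤ 2 := by
  intro b
  refine (B9Thm310CommutatorBound389B.sum_abs_qsK_le i b).trans ?_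
  have hL1 : (1 : ℝ) ≤ ((ℓ + 1 : ℕ) : ℝ) ^ (d + 1) := one_le_pow₀ (by exact_mod_cast Nat.succ_le_succ (Nat.zero_le ℓ))
  have h1 : (1 : ℝ) ≤ (((ℓ + 1 : ℕ) : ℝ) ^ (d + 1)) ^ levY i (chartY i b.src) := one_le_pow₀ hL1
  have h2 : ((((ℓ + 1 : ℕ) : ℝ) ^ (d + 1)) ^ levY i (chartY i b.src))⁻¹ ≤ 1 := inv_le_one_of_one_le₀ h1
  linarith

/-- **THE PRINTED WEIGHTS ARE BOUNDED BY THE INDEX's BAND**: `w_ι ≤ |b₁|·c_f²·(L^k)^{d+1}` — from `KIdx.hwb : GlobalBand b₀ b₁ c_f w`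
(`w_ι∕(c_f∕L^{j(ι)})² ≤ b₁(L^{j(ι)})^{d+1}`), `(L^j)² ≥ 1`, `j(ι) ≤ k`. [cite: Balaban1984PropagatorsII, (2.16) p.225, (2.18)–(2.20) p.226 («a_j(L^jη)^{−2}»), bookkeeping] -/
theorem weight_le_of_globalBand (ι : IBondY i) : i.w ι ≤ |b₁| * i.cf ^ 2 * ((((ℓ + 1 : ℕ) : ℝ)) ^ i.k) ^ (d + 1) := by
  obtain ⟨-, h2⟩ := i.hwb ι
  have hL1 : (1 : ℝ) ≤ ((ℓ + 1 : ℕ) : ℝ) := by exact_mod_cast Nat.succ_le_succ (Nat.zero_le ℓ)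
  have hLj : (1 : ℝ) ≤ ((ℓ + 1 : ℕ) : ℝ) ^ (ι.1.1 : ℕ) := one_le_pow₀ hL1
  have hLj0 : (0 : ℝ) < ((ℓ + 1 : ℕ) : ℝ) ^ (ι.1.1 : ℕ) := by positivity
  have hx : i.cf / ((ℓ + 1 : ℕ) : ℝ) ^ (ι.1.1 : ℕ) ≠ 0 := div_ne_zero i.hcf hLj0.ne'
  have hq : (0 : ℝ) < (i.cf / ((ℓ + 1 : ℕ) : ℝ) ^ (ι.1.1 : ℕ)) ^ 2 := by
    rw [← sq_abs]; exact pow_pos (abs_pos.2 hx) 2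
  have h3 : i.w ι ≤ b₁ * (((ℓ + 1 : ℕ) : ℝ) ^ (ι.1.1 : ℕ)) ^ (d + 1) * (i.cf / ((ℓ + 1 : ℕ) : ℝ) ^ (ι.1.1 : ℕ)) ^ 2 :=
    (div_le_iff₀ hq).1 h2
  have h4 : (i.cf / ((ℓ + 1 : ℕ) : ℝ) ^ (ι.1.1 : ℕ)) ^ 2 ≤ i.cf ^ 2 := by
    rw [div_pow]
    exact div_le_self (sq_nonneg _) (one_le_pow₀ hLj)
  have h5 : (((ℓ + 1 : ℕ) : ℝ) ^ (ι.1.1 : ℕ)) ^ (d + 1) ≤ ((((ℓ + 1 : ℕ) : ℝ)) ^ i.k) ^ (d + 1) :=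
    pow_le_pow_left₀ hLj0.le (pow_le_pow_right₀ hL1 (lvl_le i.hN i.D i.hk ι)) _
  have hP0 : (0 : ℝ) ≤ (((ℓ + 1 : ℕ) : ℝ) ^ (ι.1.1 : ℕ)) ^ (d + 1) := by positivity
  calc i.w ι ≤ b₁ * (((ℓ + 1 : ℕ) : ℝ) ^ (ι.1.1 : ℕ)) ^ (d + 1) * (i.cf / ((ℓ + 1 : ℕ) : ℝ) ^ (ι.1.1 : ℕ)) ^ 2 := h3
    _ ≤ |b₁| * (((ℓ + 1 : ℕ) : ℝ) ^ (ι.1.1 : ℕ)) ^ (d + 1) * (i.cf / ((ℓ + 1 : ℕ) : ℝ) ^ (ι.1.1 : ℕ)) ^ 2 :=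
        mul_le_mul_of_nonneg_right (mul_le_mul_of_nonneg_right (le_abs_self b₁) hP0) hq.le
    _ ≤ |b₁| * ((((ℓ + 1 : ℕ) : ℝ)) ^ i.k) ^ (d + 1) * i.cf ^ 2 :=
        mul_le_mul (mul_le_mul_of_nonneg_left h5 (abs_nonneg b₁)) h4 hq.le (mul_nonneg (abs_nonneg b₁) (hP0.trans h5))
    _ = |b₁| * i.cf ^ 2 * ((((ℓ + 1 : ℕ) : ℝ)) ^ i.k) ^ (d + 1) := by ring

/-- ★ **76's `hca` WITH `c_a = |b₁|·c_f²·(L^k)^{d+1}`** (the weight matrix is diagonal: `Σ_{ι′} |a(ι,ι′)| = w_ι`, `B13BondAveragingReadingNumerals.sum_abs_aK_eq`).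
[cite: Balaban1984PropagatorsII, (2.16) p.225, (2.18)–(2.20) p.226; Balaban1985BackgroundPropagators, (3.26) p.395] -/
theorem hca_of_globalBand : ∀ ι : IBondY i, ∑ ι', |aK i ι ι'| ≤ |b₁| * i.cf ^ 2 * ((((ℓ + 1 : ℕ) : ℝ)) ^ i.k) ^ (d + 1) := fun ι => by
  rw [sum_abs_aK_eq]; exact weight_le_of_globalBand i ι

/-- `0 ≤ c_a`. [cite: Balaban1984PropagatorsII, (2.16) p.225, bookkeeping] -/
theorem ca_globalBand_nonneg : (0 : ℝ) ≤ |b₁| * i.cf ^ 2 * ((((ℓ + 1 : ℕ) : ℝ)) ^ i.k) ^ (d + 1) := by positivity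

/-- `2 ≤ s = 2·(d+2)·(L^k − 1)` (`L ≥ 5`, `k ≥ 2` at def-Y's index). [cite: Balaban1984PropagatorsII, (2.1) p.224, bookkeeping] -/
theorem two_le_rangeQ2 : (2 : ℝ) ≤ 2 * (((d : ℝ) + 2) * ((((ℓ + 1) ^ i.k : ℕ) : ℝ) - 1)) := by
  have hk : i.k ≠ 0 := by have := i.hk2; omega
  have h1 : (2 : ℕ) ≤ (ℓ + 1) ^ i.k := le_trans (by have := i.hℓ; omega) (Nat.le_self_pow hk (ℓ + 1))
  have h2 : (2 : ℝ) ≤ (((ℓ + 1) ^ i.k : ℕ) : ℝ) := by exact_mod_cast h1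
  have hd0 : (0 : ℝ) ≤ d := Nat.cast_nonneg d
  nlinarith

/-- **76's `hℓp` AT THE SHARED RANGE NUMERAL `s = 2(d+2)(L^k − 1)`** (`B13BlockBondReadingNumerals.hℓp_bondReadingY` gives `2`). [cite: Balaban1985BackgroundPropagators, (3.2) p.390, (3.10) p.392, (3.108) p.416; Balaban1988RG2Cluster, (2.5) p.12] -/
theorem hℓp_bondReadingY_rangeQ2 {Nf : Fin (d + 1) → ℕ} [∀ μ, NeZero (Nf μ)] (hNf : ∀ μ, (toKT i).NB μ = Nf μ) :
    ∀ (p : PlaqY i) (m l : Fin 4), tdist1 Nf (bondReadingY i hNf (edgeY i p m)) (bondReadingY i hNf (edgeY i p l)) ≤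
      2 * (((d : ℝ) + 2) * ((((ℓ + 1) ^ i.k : ℕ) : ℝ) - 1)) :=
  fun p m l => (hℓp_bondReadingY i hNf p m l).trans (two_le_rangeQ2 i)

end Numerals

/-! ## §2–§4. ★★★ Module 76 LOCATED at `(M_N(ℂ), matrix units, bondReadingY, G-valued U₀ with G ≤ U(N))` -/

section Located

variable {N : ℕ} [NeZero N] {G : Subgroup (Matrix (Fin N) (Fin N) ℂ)ˣ}
variable {Nf : Fin (d + 1) → ℕ} [∀ μ, NeZero (Nf μ)]
variable (parS : SiteParY (Matrix (Fin N) (Fin N) ℂ) i) (Gp : SiteOpY (Matrix (Fin N) (Fin N) ℂ) i)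

open Classical in
/-- ★★ **76 §4 LOCATED — THE LOCAL PART `Δ(U) + Q*(U)aQ(U)` ALONG THE PENCIL, EVERY NODE-00 NUMERAL A NUMBER.**  For a `G`-valued background `U₀` (`G ≤ U(N)`),
in matrix-unit coordinates, with locations read by `bondReadingY`: `RawEntryLetters (A′ ↦ toMatrix (Δ(e^{iηA′}U₀) + (Q*aQ)(e^{iηA′}U₀))) (ℓF ∘ fst) Rc ρ C(η,Rc)·e^{ρs}`,
`C` = 76's constant at `K₀ = 1`, `c₁ = 4|c_f|`, `c₂ = 4(d+1)|c_f|`, `N_b = 4(d+1)`, `D = (d+2)(L^k − 1)`, `c_Q = 1`, `c_{Q*} = 2`, `c_a = |b₁|c_f²(L^k)^{d+1}`, `cb = cl = 1`,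
`s = 2(d+2)(L^k − 1)`; displayed ONLY `hG`, `hU₀`, `hNf`, `η`, `0 ≤ Rc`, `0 ≤ ρ`.
[cite: Balaban1985BackgroundPropagators, (3.26) p.395, (3.10) p.392, (3.12)–(3.13) p.392, Thm 3.4 and (3.50) p.400, Thm 3.10 (3.107)–(3.108) p.416; Balaban1988RG2Cluster, (2.5) p.12, p.15] -/
theorem rawEntryLetters_toMatrix_localDeltaA_prodCfg_located
    (hG : G ≤ B7Prop2Explicit.unitaryUnits (Matrix (Fin N) (Fin N) ℂ))
    {U₀ : CfgY (Matrix (Fin N) (Fin N) ℂ) i} (hU₀ : ∀ μ x, U₀ μ x ∈ G)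
    (hNf : ∀ μ, (toKT i).NB μ = Nf μ) (η : ℝ) {Rc : ℝ} (hRc : 0 ≤ Rc) {ρ : ℝ} (hρ : 0 ≤ ρ) :
    RawEntryLetters (fun a : Fin (d + 1) → Site (PV d ℓ i.m i.K hd hL) 0 → Matrix (Fin N) (Fin N) ℂ =>
        LinearMap.toMatrix ((Pi.basis fun _ : FBondY i => Matrix.stdBasis ℂ (Fin N) (Fin N)).reindex (Equiv.sigmaEquivProd (FBondY i) (Fin N × Fin N)))
          ((Pi.basis fun _ : FBondY i => Matrix.stdBasis ℂ (Fin N) (Fin N)).reindex (Equiv.sigmaEquivProd (FBondY i) (Fin N × Fin N)))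
          (hessY i (prodCfg U₀ η a) + QsY i (parBY i) (prodCfg U₀ η a) ∘ₗ aY i ∘ₗ QY i (parBY i) (prodCfg U₀ η a)))
      (fun p : FBondY i × (Fin N × Fin N) => bondReadingY i hNf p.1) Rc ρ
      (1 * (((4 * ((d : ℝ) + 1) * |i.cf|) * (1 * Real.exp (|η| * Rc) *
          ((1 * Real.exp (|η| * Rc)) ^ 4 * ((4 * |i.cf|) * (1 * Real.exp (|η| * Rc) * 1 * (1 * Real.exp (|η| * Rc))))) *
          (1 * Real.exp (|η| * Rc))) +
        1 / 2 * ((4 * ((d : ℝ) + 1)) * (1 * Real.exp (|η| * Rc) *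
          (2 * (i.cf ^ 2 * (1 * Real.exp (|η| * Rc)) ^ 4) * (8 * (1 * Real.exp (|η| * Rc) * 1 * (1 * Real.exp (|η| * Rc))))) *
          (1 * Real.exp (|η| * Rc))))) +
      2 * ((1 * Real.exp (|η| * Rc)) ^ ((d + 2) * ((ℓ + 1) ^ i.k - 1)) *
        ((|b₁| * i.cf ^ 2 * ((((ℓ + 1 : ℕ) : ℝ)) ^ i.k) ^ (d + 1)) * (1 * ((1 * Real.exp (|η| * Rc)) ^ ((d + 2) * ((ℓ + 1) ^ i.k - 1)) * 1 * (1 * Real.exp (|η| * Rc)) ^ ((d + 2) * ((ℓ + 1) ^ i.k - 1))))) * (1 * Real.exp (|η| * Rc)) ^ ((d + 2) * ((ℓ + 1) ^ i.k - 1)))) * Real.exp (ρ * (2 * (((d : ℝ) + 2) * ((((ℓ + 1) ^ i.k : ℕ) : ℝ) - 1))))) :=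
  (rawEntryLetters_toMatrix_localDeltaA_prodCfg_curlNumerals i (Matrix.stdBasis ℂ (Fin N) (Fin N)) U₀ η (norm_unit_le_one_of_mem i hG hU₀).1
    (norm_unit_le_one_of_mem i hG hU₀).2 le_rfl hRc (hD_qK i) (hD'_qsK i) zero_le_one zero_le_two (ca_globalBand_nonneg i) (hcQ_le_one i)
    (hcQs_le_two i) (hca_of_globalBand i) norm_stdBasis_repr_le zero_le_one norm_stdBasis_le_one zero_le_one (bondReadingY i hNf)
    (hℓp_bondReadingY_rangeQ2 i hNf) (hℓq_bondReadingY i hNf) hρ)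

open Classical in
/-- ★★ **76 §5 LOCATED — THE `Δ_a` SOCKET, EVERY NODE-00 NUMERAL A NUMBER.**  §2 + the projection term's pencil letters `hP` (the inverse road's content,
displayed verbatim at `ℓF = bondReadingY`) ⟹ the letters of `A′ ↦ toMatrix (Δ_a(e^{iηA′}U₀))`, constant `C(η,Rc)·e^{ρs} + B_P`.
[cite: Balaban1985BackgroundPropagators, (3.25)–(3.26) pp.394–395, Thm 3.4 and (3.50) p.400, (3.108) p.416; Balaban1988RG2Cluster, (2.5) p.12, p.15] -/
theorem rawEntryLetters_toMatrix_deltaAY_prodCfg_of_projection_located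
    (hG : G ≤ B7Prop2Explicit.unitaryUnits (Matrix (Fin N) (Fin N) ℂ))
    {U₀ : CfgY (Matrix (Fin N) (Fin N) ℂ) i} (hU₀ : ∀ μ x, U₀ μ x ∈ G)
    (hNf : ∀ μ, (toKT i).NB μ = Nf μ) (η : ℝ) {Rc : ℝ} (hRc : 0 ≤ Rc) {ρ : ℝ} (hρ : 0 ≤ ρ)

    {BP : ℝ}
    (hP : RawEntryLetters (fun a : Fin (d + 1) → Site (PV d ℓ i.m i.K hd hL) 0 → Matrix (Fin N) (Fin N) ℂ =>
        LinearMap.toMatrix ((Pi.basis fun _ : FBondY i => Matrix.stdBasis ℂ (Fin N) (Fin N)).reindex (Equiv.sigmaEquivProd (FBondY i) (Fin N × Fin N)))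
          ((Pi.basis fun _ : FBondY i => Matrix.stdBasis ℂ (Fin N) (Fin N)).reindex (Equiv.sigmaEquivProd (FBondY i) (Fin N × Fin N)))
          (gradY i (prodCfg U₀ η a) ∘ₗ RY i parS Gp (prodCfg U₀ η a) ∘ₗ divY i (prodCfg U₀ η a)))
      (fun p : FBondY i × (Fin N × Fin N) => bondReadingY i hNf p.1) Rc ρ BP) :
    RawEntryLetters (fun a : Fin (d + 1) → Site (PV d ℓ i.m i.K hd hL) 0 → Matrix (Fin N) (Fin N) ℂ =>
        LinearMap.toMatrix ((Pi.basis fun _ : FBondY i => Matrix.stdBasis ℂ (Fin N) (Fin N)).reindex (Equiv.sigmaEquivProd (FBondY i) (Fin N × Fin N)))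
          ((Pi.basis fun _ : FBondY i => Matrix.stdBasis ℂ (Fin N) (Fin N)).reindex (Equiv.sigmaEquivProd (FBondY i) (Fin N × Fin N))) (deltaAY i parS (parBY i) Gp (prodCfg U₀ η a)))
      (fun p : FBondY i × (Fin N × Fin N) => bondReadingY i hNf p.1) Rc ρ
      (1 * (((4 * ((d : ℝ) + 1) * |i.cf|) * (1 * Real.exp (|η| * Rc) *
          ((1 * Real.exp (|η| * Rc)) ^ 4 * ((4 * |i.cf|) * (1 * Real.exp (|η| * Rc) * 1 * (1 * Real.exp (|η| * Rc))))) *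
          (1 * Real.exp (|η| * Rc))) +
        1 / 2 * ((4 * ((d : ℝ) + 1)) * (1 * Real.exp (|η| * Rc) *
          (2 * (i.cf ^ 2 * (1 * Real.exp (|η| * Rc)) ^ 4) * (8 * (1 * Real.exp (|η| * Rc) * 1 * (1 * Real.exp (|η| * Rc))))) *
          (1 * Real.exp (|η| * Rc))))) +
      2 * ((1 * Real.exp (|η| * Rc)) ^ ((d + 2) * ((ℓ + 1) ^ i.k - 1)) *
        ((|b₁| * i.cf ^ 2 * ((((ℓ + 1 : ℕ) : ℝ)) ^ i.k) ^ (d + 1)) * (1 * ((1 * Real.exp (|η| * Rc)) ^ ((d + 2) * ((ℓ + 1) ^ i.k - 1)) * 1 * (1 * Real.exp (|η| * Rc)) ^ ((d + 2) * ((ℓ + 1) ^ i.k - 1))))) * (1 * Real.exp (|η| * Rc)) ^ ((d + 2) * ((ℓ + 1) ^ i.k - 1)))) * Real.exp (ρ * (2 * (((d : ℝ) + 2) * ((((ℓ + 1) ^ i.k : ℕ) : ℝ) - 1)))) + BP) :=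
  (rawEntryLetters_toMatrix_deltaAY_prodCfg_of_projection_curlNumerals i (Matrix.stdBasis ℂ (Fin N) (Fin N)) parS Gp U₀ η
    (norm_unit_le_one_of_mem i hG hU₀).1 (norm_unit_le_one_of_mem i hG hU₀).2 le_rfl hRc (hD_qK i) (hD'_qsK i) zero_le_one zero_le_two
    (ca_globalBand_nonneg i) (hcQ_le_one i) (hcQs_le_two i) (hca_of_globalBand i) norm_stdBasis_repr_le zero_le_one norm_stdBasis_le_one zero_le_one
    (bondReadingY i hNf) (hℓp_bondReadingY_rangeQ2 i hNf) (hℓq_bondReadingY i hNf) hρ hP)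

open Classical in
/-- ★★★ **76 §6 LOCATED — THE G-JUNCTION MODULO THE PROJECTION TERM, EVERY NODE-00 NUMERAL A NUMBER** (Sect. B's (3.84)–(3.86) for `G = Δ_a⁻¹` at NODE 00's
objects along pv27's pencil, in matrix-unit coordinates, locations read by `bondReadingY`, fibre `m = (d+1)·N²`).  DISPLAYED ONLY: `hG`, `hU₀`, `hNf`, `η`,
`0 < Rc`, `0 ≤ ρ`, the projection term's pencil letters `hP`, N06's `IsUnit (Δ_a(U₀))` and pointwise (3.108)-type bound `hO` (constant `B_G ≥ 0`, rate `ρ`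
through `ℓF`) at the ONE real background, the target rate `0 ≤ ρ′ < ρ`.
[cite: Balaban1985BackgroundPropagators, (3.26)–(3.27) p.395, Thm 3.4 and (3.50) p.400, (3.84)–(3.86) p.407, Thm 3.10 (3.107)–(3.108) p.416; Balaban1988RG2Cluster, (2.5)–(2.7) pp.12–13, p.15; Balaban1984PropagatorsII, Lemma 2.1 (2.61) p.234] -/
theorem rawEntryLetters_toMatrix_GAY_prodCfg_of_projection_located
    (hG : G ≤ B7Prop2Explicit.unitaryUnits (Matrix (Fin N) (Fin N) ℂ))
    {U₀ : CfgY (Matrix (Fin N) (Fin N) ℂ) i} (hU₀ : ∀ μ x, U₀ μ x ∈ G)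
    (hNf : ∀ μ, (toKT i).NB μ = Nf μ) (η : ℝ) {Rc : ℝ} (hRc : 0 < Rc) {ρ : ℝ} (hρ : 0 ≤ ρ)

    {BP : ℝ}
    (hP : RawEntryLetters (fun a : Fin (d + 1) → Site (PV d ℓ i.m i.K hd hL) 0 → Matrix (Fin N) (Fin N) ℂ =>
        LinearMap.toMatrix ((Pi.basis fun _ : FBondY i => Matrix.stdBasis ℂ (Fin N) (Fin N)).reindex (Equiv.sigmaEquivProd (FBondY i) (Fin N × Fin N)))
          ((Pi.basis fun _ : FBondY i => Matrix.stdBasis ℂ (Fin N) (Fin N)).reindex (Equiv.sigmaEquivProd (FBondY i) (Fin N × Fin N)))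
          (gradY i (prodCfg U₀ η a) ∘ₗ RY i parS Gp (prodCfg U₀ η a) ∘ₗ divY i (prodCfg U₀ η a)))
      (fun p : FBondY i × (Fin N × Fin N) => bondReadingY i hNf p.1) Rc ρ BP)
    (hunit : IsUnit (deltaAY i parS (parBY i) Gp U₀)) {BG : ℝ} (hBG : 0 ≤ BG)
    (hO : ∀ b' c (E : Matrix (Fin N) (Fin N) ℂ),
      ‖GAY i parS (parBY i) Gp U₀ (Pi.single b' E) c‖ ≤ BG * ‖E‖ * Real.exp (-(ρ * tdist1 Nf (bondReadingY i hNf c) (bondReadingY i hNf b'))))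
    {ρ' : ℝ} (hρ'0 : 0 ≤ ρ') (hρ' : ρ' < ρ) :
    RawEntryLetters (fun a : Fin (d + 1) → Site (PV d ℓ i.m i.K hd hL) 0 → Matrix (Fin N) (Fin N) ℂ =>
        LinearMap.toMatrix ((Pi.basis fun _ : FBondY i => Matrix.stdBasis ℂ (Fin N) (Fin N)).reindex (Equiv.sigmaEquivProd (FBondY i) (Fin N × Fin N)))
          ((Pi.basis fun _ : FBondY i => Matrix.stdBasis ℂ (Fin N) (Fin N)).reindex (Equiv.sigmaEquivProd (FBondY i) (Fin N × Fin N))) (GAY i parS (parBY i) Gp (prodCfg U₀ η a)))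
      (fun p : FBondY i × (Fin N × Fin N) => bondReadingY i hNf p.1)
      (Rc / (4 * ((1 * (((4 * ((d : ℝ) + 1) * |i.cf|) * (1 * Real.exp (|η| * Rc) *
          ((1 * Real.exp (|η| * Rc)) ^ 4 * ((4 * |i.cf|) * (1 * Real.exp (|η| * Rc) * 1 * (1 * Real.exp (|η| * Rc))))) *
          (1 * Real.exp (|η| * Rc))) +
        1 / 2 * ((4 * ((d : ℝ) + 1)) * (1 * Real.exp (|η| * Rc) *
          (2 * (i.cf ^ 2 * (1 * Real.exp (|η| * Rc)) ^ 4) * (8 * (1 * Real.exp (|η| * Rc) * 1 * (1 * Real.exp (|η| * Rc))))) *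
          (1 * Real.exp (|η| * Rc))))) +
      2 * ((1 * Real.exp (|η| * Rc)) ^ ((d + 2) * ((ℓ + 1) ^ i.k - 1)) *
        ((|b₁| * i.cf ^ 2 * ((((ℓ + 1 : ℕ) : ℝ)) ^ i.k) ^ (d + 1)) * (1 * ((1 * Real.exp (|η| * Rc)) ^ ((d + 2) * ((ℓ + 1) ^ i.k - 1)) * 1 * (1 * Real.exp (|η| * Rc)) ^ ((d + 2) * ((ℓ + 1) ^ i.k - 1))))) * (1 * Real.exp (|η| * Rc)) ^ ((d + 2) * ((ℓ + 1) ^ i.k - 1)))) * Real.exp (ρ * (2 * (((d : ℝ) + 2) * ((((ℓ + 1) ^ i.k : ℕ) : ℝ) - 1)))) + BP) *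
          (1 * 1 * BG) * ((((d + 1) * (N * N) : ℕ) : ℝ) * B6.c0 1 ((ρ - ρ') / 3) ^ (d + 1)) * ((((d + 1) * (N * N) : ℕ) : ℝ) * B6.c0 1 ((ρ - ρ') / 3) ^ (d + 1))) + 1))
      ρ' (2 * (1 * 1 * BG)) :=
  (rawEntryLetters_toMatrix_GAY_prodCfg_of_projection_curlNumerals i (Matrix.stdBasis ℂ (Fin N) (Fin N)) parS Gp U₀ η
    (norm_unit_le_one_of_mem i hG hU₀).1 (norm_unit_le_one_of_mem i hG hU₀).2 le_rfl hRc (hD_qK i) (hD'_qsK i) zero_le_one zero_le_two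
    (ca_globalBand_nonneg i) (hcQ_le_one i) (hcQs_le_two i) (hca_of_globalBand i) norm_stdBasis_repr_le zero_le_one norm_stdBasis_le_one zero_le_one
    (bondReadingY i hNf) (hℓp_bondReadingY_rangeQ2 i hNf) (hℓq_bondReadingY i hNf) (card_fibre_bondReadingY_matrixUnits i hNf) hρ hP hunit hBG hO
    hρ'0 hρ')

end Located

end Literature.MathematicalPhysics.QuantumFieldTheory.Balaban1983to89.B13DeltaAPencilLettersLocated

end
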